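import Literature.AnabelianGeometry.AbsoluteAnabelian.NFDecompositionNonCommensurableProofs
import Literature.AnabelianGeometry.AbsoluteAnabelian.NFDecompositionNestedProofs
import HarnessLib

/-!
# The Neukirch–Uchida deduction, row R1: the prime correspondence of a partial isomorphism of `G_F`
# from the containment lemma [NSW] (12.1.9)

J. Neukirch, A. Schmidt, K. Wingberg, *Cohomology of Number Fields* (2nd ed.), Ch. XII: Prop. (12.1.9)
(a closed subgroup of `G_F` of local type lies in a decomposition group) and the first step of the
proof of Thm. (12.2.1) (Neukirch–Uchida): an isomorphism `α : U₁ ⥲ U₂` between open subgroups of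
`G_F = Gal(F̄/F)` induces a BIJECTION `A ↦ π(A)` of the nonarchimedean primes of `F̄` (nontrivial
valuation subrings `A ≠ ⊤` of `F̄`), characterised by `α(D_A ∩ U₁) = D_{π(A)} ∩ U₂` for the
decomposition groups (stabilisers) `D_A ⊆ G_F`, and compatible with the actions
(`π(u • A) = α(u) • π(A)`, `u ∈ U₁`).

PROOF-ONLY (no `def`).  abc-iut cell, GAP-LEDGER row G-L4d2g4-1, sub-DAG
`plan/L4/SUBDAG-NeukirchUchida.md` row R1 (abc-iut-L4-d2).  The containment lemma (12.1.9) is NOT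
proved here: it enters as the explicit hypotheses `hα`, `hα'` (for `α` and `α⁻¹`), in the
`Subgroup.map`/`subgroupOf` spelling of `NeukirchUchida.map_stabilizer_subgroupOf` (abc-iut-w5-d201);
everything else is group theory over the tree's non-commensurability of decomposition groups of
distinct primes (`relIndex_decompositionGroupNF_eq_zero_of_ne`, [NSW] Cor. 12.1.3):

* `eq_of_stabilizer_inf_le` — for a finite-index `V ≤ G_F` (e.g. an open subgroup):
  `D_A ∩ V ≤ D_B ⇒ A = B` (the relative decomposition group `D_A ∩ V` still determines `A`);
* `exists_map_stabilizer_subgroupOf_eq` — from (12.1.9) for `α` and `α⁻¹`: for every `A ≠ ⊤` there is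
  `B ≠ ⊤` with `α(D_A ∩ U₁) = D_B ∩ U₂` (EQUALITY; the pattern of
  `map_decompositionGroupNF_eq_of_forall_exists_le`, abc-iut-w6-d038, now for partial isomorphisms);
* `eq_of_map_eq_of_map_le` — such a `B` is unique (`π` is well defined); `map_symm_eq_of_map_eq` — `α⁻¹`
  carries `D_B ∩ U₂` back onto `D_A ∩ U₁` (`π` is a bijection with inverse the correspondence of `α⁻¹`);
* `map_stabilizer_smul_subgroupOf_eq` — `α(D_{u•A} ∩ U₁) = D_{α(u)•B} ∩ U₂`: `π(u • A) = α(u) • π(A)`;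
* `map_stabilizer_subgroupOf_inf_eq` — `α(D_A ∩ V) = D_B ∩ α(V)` for every `V ≤ U₁`.

HONEST FRAMING: classical group theory / algebraic number theory, outside the [IUTchIII] Cor. 3.12
cone; (12.1.9) remains a hypothesis; nothing here takes a side.

## References
* [NeukirchSchmidtWingberg2008] Neukirch–Schmidt–Wingberg, *Cohomology of Number Fields*, (12.1.9), (12.2.1), Cor. 12.1.3.
* [MochizukiAbsAnab2004] S. Mochizuki, *The absolute anabelian geometry of hyperbolic curves*, Thm. 1.1.3 p. 6.
-/

noncomputable section

open scoped Pointwise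
open Field

namespace Literature.AnabelianGeometry.AbsoluteAnabelian

namespace NeukirchUchidaProof

variable {F : Type} [Field F]

/-! ### Relative decomposition groups determine the prime -/

/-- **`D_A ∩ V ≤ D_B ⇒ A = B` for a finite-index `V ≤ G_F`** ([NSW] Cor. 12.1.3, relative form): the
decomposition groups of two DISTINCT nonarchimedean primes of `F̄` are non-commensurable
(`relIndex_decompositionGroupNF_eq_zero_of_ne`), while `D_A ∩ V` has finite index in `D_A`.
[cite: NeukirchSchmidtWingberg2008, Cor. 12.1.3] -/
theorem eq_of_stabilizer_inf_le [NumberField F] (V : Subgroup (absoluteGaloisGroup F)) [V.FiniteIndex]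
    {A B : ValuationSubring (AlgebraicClosure F)} (hA : A ≠ ⊤) (hB : B ≠ ⊤)
    (h : MulAction.stabilizer (absoluteGaloisGroup F) A ⊓ V ≤
      MulAction.stabilizer (absoluteGaloisGroup F) B) :
    A = B := by
  by_contra hne
  have h0 := relIndex_decompositionGroupNF_eq_zero_of_ne A B hA hB hne
  rw [decompositionGroupNF_eq_stabilizer, decompositionGroupNF_eq_stabilizer] at h0
  have h1 : (MulAction.stabilizer (absoluteGaloisGroup F) A ⊓ V).relIndex
      (MulAction.stabilizer (absoluteGaloisGroup F) A) = 0 :=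
    Subgroup.relIndex_eq_zero_of_le_left h h0
  rw [Subgroup.inf_relIndex_left] at h1
  exact Subgroup.FiniteIndex.index_ne_zero h1

/-- An open subgroup of the (compact) absolute Galois group of a number field has finite index —
bookkeeping so that the statements below apply to OPEN `U₁, U₂` as in `NeukirchUchida F`. [folklore] -/
private theorem finiteIndex_of_isOpen [NumberField F] (U : Subgroup (absoluteGaloisGroup F))
    (hU : IsOpen (U : Set (absoluteGaloisGroup F))) : U.FiniteIndex := by
  haveI : Finite (absoluteGaloisGroup F ⧸ U) := Subgroup.quotient_finite_of_isOpen U hU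
  exact Subgroup.finiteIndex_of_finite_quotient

/-- `D_A ∩ V ≤ D_B ⇒ A = B` for an OPEN `V ≤ G_F`. [cite: NeukirchSchmidtWingberg2008, Cor. 12.1.3] -/
theorem eq_of_stabilizer_inf_le_of_isOpen [NumberField F] (V : Subgroup (absoluteGaloisGroup F))
    (hV : IsOpen (V : Set (absoluteGaloisGroup F)))
    {A B : ValuationSubring (AlgebraicClosure F)} (hA : A ≠ ⊤) (hB : B ≠ ⊤)
    (h : MulAction.stabilizer (absoluteGaloisGroup F) A ⊓ V ≤
      MulAction.stabilizer (absoluteGaloisGroup F) B) :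
    A = B := by
  haveI := finiteIndex_of_isOpen V hV
  exact eq_of_stabilizer_inf_le V hA hB h

/-! ### From containment to equality: the correspondence `A ↦ B` -/

variable {U₁ U₂ : Subgroup (absoluteGaloisGroup F)}

/-- Unfolding: `v ∈ α(D_A ∩ U₁)` iff `α⁻¹ v ∈ D_A`. [folklore] -/
private theorem mem_map_stabilizer_subgroupOf_iff (α : U₁ ≃* U₂)
    (A : ValuationSubring (AlgebraicClosure F)) (v : U₂) :
    v ∈ ((MulAction.stabilizer (absoluteGaloisGroup F) A).subgroupOf U₁).map α.toMonoidHom ↔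
      ((α.symm v : U₁) : absoluteGaloisGroup F) ∈ MulAction.stabilizer (absoluteGaloisGroup F) A := by
  constructor
  · rintro ⟨u, hu, rfl⟩
    rw [MulEquiv.coe_toMonoidHom, MulEquiv.symm_apply_apply]
    exact hu
  · intro hv
    exact ⟨α.symm v, hv, α.apply_symm_apply v⟩

/-- **Containment both ways forces equality** (the group-theoretic step (12.1.9) ⇒ (12.2.1) for a
PARTIAL isomorphism `α : U₁ ⥲ U₂`, `U₁` of finite index): if `α` maps every `D_A ∩ U₁` INTO some `D_B`
and `α⁻¹` maps every `D_B ∩ U₂` INTO some `D_A`, then `α(D_A ∩ U₁) = D_B ∩ U₂`.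
[cite: NeukirchSchmidtWingberg2008, Thm. 12.2.1 (proof, first step)] -/
theorem exists_map_stabilizer_subgroupOf_eq [NumberField F] [U₁.FiniteIndex] (α : U₁ ≃* U₂)
    (hα : ∀ A : ValuationSubring (AlgebraicClosure F), A ≠ ⊤ →
      ∃ B : ValuationSubring (AlgebraicClosure F), B ≠ ⊤ ∧
        ((MulAction.stabilizer (absoluteGaloisGroup F) A).subgroupOf U₁).map α.toMonoidHom ≤
          (MulAction.stabilizer (absoluteGaloisGroup F) B).subgroupOf U₂)
    (hα' : ∀ B : ValuationSubring (AlgebraicClosure F), B ≠ ⊤ →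
      ∃ A : ValuationSubring (AlgebraicClosure F), A ≠ ⊤ ∧
        ((MulAction.stabilizer (absoluteGaloisGroup F) B).subgroupOf U₂).map α.symm.toMonoidHom ≤
          (MulAction.stabilizer (absoluteGaloisGroup F) A).subgroupOf U₁)
    (A : ValuationSubring (AlgebraicClosure F)) (hA : A ≠ ⊤) :
    ∃ B : ValuationSubring (AlgebraicClosure F), B ≠ ⊤ ∧
      ((MulAction.stabilizer (absoluteGaloisGroup F) A).subgroupOf U₁).map α.toMonoidHom =
        (MulAction.stabilizer (absoluteGaloisGroup F) B).subgroupOf U₂ := by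
  obtain ⟨B, hB, hle⟩ := hα A hA
  obtain ⟨A', hA', hle'⟩ := hα' B hB
  -- `D_A ∩ U₁ ≤ α⁻¹(D_B ∩ U₂) ≤ D_{A'}`, hence `A = A'`
  have hAA' : MulAction.stabilizer (absoluteGaloisGroup F) A ⊓ U₁ ≤
      MulAction.stabilizer (absoluteGaloisGroup F) A' := by
    intro g hg
    have h1 : α ⟨g, hg.2⟩ ∈ (MulAction.stabilizer (absoluteGaloisGroup F) B).subgroupOf U₂ :=
      hle ⟨⟨g, hg.2⟩, hg.1, rfl⟩
    have h2 : α.symm (α ⟨g, hg.2⟩) ∈ (MulAction.stabilizer (absoluteGaloisGroup F) A').subgroupOf U₁ :=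
      hle' ⟨α ⟨g, hg.2⟩, h1, rfl⟩
    rw [MulEquiv.symm_apply_apply] at h2
    exact h2
  have hAeq : A = A' := eq_of_stabilizer_inf_le U₁ hA hA' hAA'
  subst hAeq
  refine ⟨B, hB, le_antisymm hle ?_⟩
  intro v hv
  have h3 : α.symm v ∈ (MulAction.stabilizer (absoluteGaloisGroup F) A).subgroupOf U₁ :=
    hle' ⟨v, hv, rfl⟩
  exact ⟨α.symm v, h3, α.apply_symm_apply v⟩

/-- **The correspondence is well defined**: if `α(D_A ∩ U₁) = D_B ∩ U₂` and `α(D_A ∩ U₁) ≤ D_{B'}`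
with `U₂` of finite index, then `B = B'`. [cite: NeukirchSchmidtWingberg2008, Thm. 12.2.1 (proof)] -/
theorem eq_of_map_eq_of_map_le [NumberField F] [U₂.FiniteIndex] (α : U₁ ≃* U₂)
    {A B B' : ValuationSubring (AlgebraicClosure F)} (hB : B ≠ ⊤) (hB' : B' ≠ ⊤)
    (h : ((MulAction.stabilizer (absoluteGaloisGroup F) A).subgroupOf U₁).map α.toMonoidHom =
      (MulAction.stabilizer (absoluteGaloisGroup F) B).subgroupOf U₂)
    (h' : ((MulAction.stabilizer (absoluteGaloisGroup F) A).subgroupOf U₁).map α.toMonoidHom ≤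
      (MulAction.stabilizer (absoluteGaloisGroup F) B').subgroupOf U₂) :
    B = B' := by
  rw [h] at h'
  refine eq_of_stabilizer_inf_le U₂ hB hB' ?_
  intro g hg
  exact h' (show (⟨g, hg.2⟩ : U₂) ∈ _ from hg.1)

/-- **The correspondence is a bijection**: if `α(D_A ∩ U₁) = D_B ∩ U₂` then
`α⁻¹(D_B ∩ U₂) = D_A ∩ U₁`. [cite: NeukirchSchmidtWingberg2008, Thm. 12.2.1 (proof)] -/
theorem map_symm_eq_of_map_eq (α : U₁ ≃* U₂) {A B : ValuationSubring (AlgebraicClosure F)}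
    (h : ((MulAction.stabilizer (absoluteGaloisGroup F) A).subgroupOf U₁).map α.toMonoidHom =
      (MulAction.stabilizer (absoluteGaloisGroup F) B).subgroupOf U₂) :
    ((MulAction.stabilizer (absoluteGaloisGroup F) B).subgroupOf U₂).map α.symm.toMonoidHom =
      (MulAction.stabilizer (absoluteGaloisGroup F) A).subgroupOf U₁ := by
  rw [← h, Subgroup.map_map]
  have : α.symm.toMonoidHom.comp α.toMonoidHom = MonoidHom.id U₁ := by
    ext u
    simp
  rw [this, Subgroup.map_id]

/-- `x` stabilises `g • a` iff `g⁻¹ x g` stabilises `a`. [folklore] -/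
private theorem mem_stabilizer_smul_iff' {G X : Type*} [Group G] [MulAction G X] (g x : G) (a : X) :
    x ∈ MulAction.stabilizer G (g • a) ↔ g⁻¹ * x * g ∈ MulAction.stabilizer G a := by
  rw [MulAction.mem_stabilizer_iff, MulAction.mem_stabilizer_iff, mul_smul, mul_smul, inv_smul_eq_iff]

/-- **Equivariance `π(u • A) = α(u) • π(A)`**: if `α(D_A ∩ U₁) = D_B ∩ U₂` then for `u ∈ U₁`,
`α(D_{u•A} ∩ U₁) = D_{α(u)•B} ∩ U₂` (`D_{u•A} = u D_A u⁻¹` and `α` is multiplicative).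
[cite: NeukirchSchmidtWingberg2008, Thm. 12.2.1 (proof)] -/
theorem map_stabilizer_smul_subgroupOf_eq (α : U₁ ≃* U₂) {A B : ValuationSubring (AlgebraicClosure F)}
    (h : ((MulAction.stabilizer (absoluteGaloisGroup F) A).subgroupOf U₁).map α.toMonoidHom =
      (MulAction.stabilizer (absoluteGaloisGroup F) B).subgroupOf U₂) (u : U₁) :
    ((MulAction.stabilizer (absoluteGaloisGroup F) ((u : absoluteGaloisGroup F) • A)).subgroupOf U₁).map
        α.toMonoidHom =
      (MulAction.stabilizer (absoluteGaloisGroup F) (((α u : U₂) : absoluteGaloisGroup F) • B)).subgroupOf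
        U₂ := by
  ext v
  rw [mem_map_stabilizer_subgroupOf_iff, Subgroup.mem_subgroupOf, mem_stabilizer_smul_iff',
    mem_stabilizer_smul_iff']
  -- `u⁻¹ (α⁻¹ v) u ∈ D_A ↔ (α u)⁻¹ v (α u) ∈ D_B`, through `h` and multiplicativity of `α`
  have key : (u⁻¹ * α.symm v * u : U₁) ∈ (MulAction.stabilizer (absoluteGaloisGroup F) A).subgroupOf U₁ ↔
      ((α u)⁻¹ * v * α u : U₂) ∈ (MulAction.stabilizer (absoluteGaloisGroup F) B).subgroupOf U₂ := by
    rw [← h]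
    constructor
    · intro hw
      refine ⟨u⁻¹ * α.symm v * u, hw, ?_⟩
      rw [MulEquiv.coe_toMonoidHom, map_mul, map_mul, map_inv, MulEquiv.apply_symm_apply]
    · rintro ⟨w, hw, hwv⟩
      rw [MulEquiv.coe_toMonoidHom] at hwv
      have : w = u⁻¹ * α.symm v * u := by
        apply α.injective
        rw [map_mul, map_mul, map_inv, MulEquiv.apply_symm_apply, hwv]
      rw [← this]
      exact hw
  rw [Subgroup.mem_subgroupOf, Subgroup.mem_subgroupOf] at key
  simpa using key

/-- **Restriction to smaller subgroups**: if `α(D_A ∩ U₁) = D_B ∩ U₂` then for every `V ≤ U₁`,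
`α(D_A ∩ V) = D_B ∩ α(V)` (intersect with `V`; `α` is injective).
[cite: NeukirchSchmidtWingberg2008, Thm. 12.2.1 (proof)] -/
theorem map_stabilizer_subgroupOf_inf_eq (α : U₁ ≃* U₂) {A B : ValuationSubring (AlgebraicClosure F)}
    (h : ((MulAction.stabilizer (absoluteGaloisGroup F) A).subgroupOf U₁).map α.toMonoidHom =
      (MulAction.stabilizer (absoluteGaloisGroup F) B).subgroupOf U₂) (V : Subgroup U₁) :
    ((MulAction.stabilizer (absoluteGaloisGroup F) A).subgroupOf U₁ ⊓ V).map α.toMonoidHom =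
      (MulAction.stabilizer (absoluteGaloisGroup F) B).subgroupOf U₂ ⊓ V.map α.toMonoidHom := by
  rw [Subgroup.map_inf _ _ α.toMonoidHom α.injective, h]

/-- **Injectivity of the correspondence**: if `α(D_A ∩ U₁) = D_B ∩ U₂ = α(D_{A'} ∩ U₁)` with `U₁` of
finite index, then `A = A'`. [cite: NeukirchSchmidtWingberg2008, Thm. 12.2.1 (proof)] -/
theorem eq_of_map_eq_of_map_eq [NumberField F] [U₁.FiniteIndex] (α : U₁ ≃* U₂)
    {A A' B : ValuationSubring (AlgebraicClosure F)} (hA : A ≠ ⊤) (hA' : A' ≠ ⊤)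
    (h : ((MulAction.stabilizer (absoluteGaloisGroup F) A).subgroupOf U₁).map α.toMonoidHom =
      (MulAction.stabilizer (absoluteGaloisGroup F) B).subgroupOf U₂)
    (h' : ((MulAction.stabilizer (absoluteGaloisGroup F) A').subgroupOf U₁).map α.toMonoidHom =
      (MulAction.stabilizer (absoluteGaloisGroup F) B).subgroupOf U₂) :
    A = A' :=
  eq_of_map_eq_of_map_le α.symm hA hA' (map_symm_eq_of_map_eq α h) (map_symm_eq_of_map_eq α h').le

/-- **The prime correspondence, packaged** ([NSW] (12.2.1), first step of the proof, for a partial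
isomorphism `α : U₁ ⥲ U₂` between finite-index subgroups of `G_F`, from the containment lemma (12.1.9)
for `α` and `α⁻¹`): every nonarchimedean prime `A` of `F̄` has a UNIQUE partner `B` with
`α(D_A ∩ U₁) = D_B ∩ U₂`. [cite: NeukirchSchmidtWingberg2008, Thm. 12.2.1 (proof, first step)] -/
theorem existsUnique_map_stabilizer_subgroupOf_eq [NumberField F] [U₁.FiniteIndex] [U₂.FiniteIndex]
    (α : U₁ ≃* U₂)
    (hα : ∀ A : ValuationSubring (AlgebraicClosure F), A ≠ ⊤ →
      ∃ B : ValuationSubring (AlgebraicClosure F), B ≠ ⊤ ∧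
        ((MulAction.stabilizer (absoluteGaloisGroup F) A).subgroupOf U₁).map α.toMonoidHom ≤
          (MulAction.stabilizer (absoluteGaloisGroup F) B).subgroupOf U₂)
    (hα' : ∀ B : ValuationSubring (AlgebraicClosure F), B ≠ ⊤ →
      ∃ A : ValuationSubring (AlgebraicClosure F), A ≠ ⊤ ∧
        ((MulAction.stabilizer (absoluteGaloisGroup F) B).subgroupOf U₂).map α.symm.toMonoidHom ≤
          (MulAction.stabilizer (absoluteGaloisGroup F) A).subgroupOf U₁)
    (A : ValuationSubring (AlgebraicClosure F)) (hA : A ≠ ⊤) :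
    ∃! B : ValuationSubring (AlgebraicClosure F), B ≠ ⊤ ∧
      ((MulAction.stabilizer (absoluteGaloisGroup F) A).subgroupOf U₁).map α.toMonoidHom =
        (MulAction.stabilizer (absoluteGaloisGroup F) B).subgroupOf U₂ := by
  obtain ⟨B, hB, h⟩ := exists_map_stabilizer_subgroupOf_eq α hα hα' A hA
  exact ⟨B, ⟨hB, h⟩, fun B' hB' => (eq_of_map_eq_of_map_le α hB hB'.1 h hB'.2.le).symm⟩

/-- The same for OPEN subgroups `U₁, U₂ ≤ G_F` and a topological isomorphism `α : U₁ ≃ₜ* U₂` — the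
binders of the named fact `NeukirchUchida F` (abc-iut-w5-d201) and of its consequence (N2)
`NeukirchUchida.exists_map_stabilizer_eq`, which this theorem now derives from (12.1.9) alone (taken as
the hypotheses `hα`, `hα'`). [cite: NeukirchSchmidtWingberg2008, Thm. 12.2.1 (proof, first step)] -/
theorem existsUnique_map_stabilizer_subgroupOf_eq_of_isOpen [NumberField F]
    (hU₁ : IsOpen (U₁ : Set (absoluteGaloisGroup F))) (hU₂ : IsOpen (U₂ : Set (absoluteGaloisGroup F)))
    (α : U₁ ≃ₜ* U₂)
    (hα : ∀ A : ValuationSubring (AlgebraicClosure F), A ≠ ⊤ →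
      ∃ B : ValuationSubring (AlgebraicClosure F), B ≠ ⊤ ∧
        ((MulAction.stabilizer (absoluteGaloisGroup F) A).subgroupOf U₁).map α.toMulEquiv.toMonoidHom ≤
          (MulAction.stabilizer (absoluteGaloisGroup F) B).subgroupOf U₂)
    (hα' : ∀ B : ValuationSubring (AlgebraicClosure F), B ≠ ⊤ →
      ∃ A : ValuationSubring (AlgebraicClosure F), A ≠ ⊤ ∧
        ((MulAction.stabilizer (absoluteGaloisGroup F) B).subgroupOf U₂).map
            α.toMulEquiv.symm.toMonoidHom ≤
          (MulAction.stabilizer (absoluteGaloisGroup F) A).subgroupOf U₁)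
    (A : ValuationSubring (AlgebraicClosure F)) (hA : A ≠ ⊤) :
    ∃! B : ValuationSubring (AlgebraicClosure F), B ≠ ⊤ ∧
      ((MulAction.stabilizer (absoluteGaloisGroup F) A).subgroupOf U₁).map α.toMulEquiv.toMonoidHom =
        (MulAction.stabilizer (absoluteGaloisGroup F) B).subgroupOf U₂ := by
  haveI := finiteIndex_of_isOpen U₁ hU₁
  haveI := finiteIndex_of_isOpen U₂ hU₂
  exact existsUnique_map_stabilizer_subgroupOf_eq α.toMulEquiv hα hα' A hA

end NeukirchUchidaProof

end Literature.AnabelianGeometry.AbsoluteAnabelian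

end
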